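import Summits.BirchSwinnertonDyer.BirchSwinnertonDyer.Theorems.EisensteinDepletionAtTwoStarGO2KEtaHondaPointA
import Mathlib.RingTheory.PowerSeries.Substitution
import Mathlib.RingTheory.PowerSeries.Expand
import Mathlib.NumberTheory.Padics.RingHoms
import Mathlib.RingTheory.WittVector.FrobeniusFractionField
import Mathlib.RingTheory.WittVector.Compare
import Mathlib.FieldTheory.IsAlgClosed.AlgebraicClosure
import Literature.NumberTheory.EllipticCurves.PAdicLFunction
import Literature.NumberTheory.EllipticCurves.LFunctionPrimeCoeff
import Literature.NumberTheory.EllipticCurves.PAdicGrossZagierConstantTermProofs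
import Literature.NumberTheory.EllipticCurves.Greenberg1999.TwoTorsionMuInvariant
import Summits.BirchSwinnertonDyer.BirchSwinnertonDyer.Theorems.EisensteinDepletionAtTwoStarGO2KEtaLineAdapter
import Summits.BirchSwinnertonDyer.BirchSwinnertonDyer.Theorems.EisensteinDepletionAtTwoStarGO2KEtaHondaPointPattern
import Summits.BirchSwinnertonDyer.BirchSwinnertonDyer.Theorems.EisensteinDepletionAtTwoStarOptBNSFKummerAlg
import HarnessLib

/-!
# THEOREM K AT THE HONDA POINT — part 10b-B: §D the Honda point `Z_c = exp_W(c·ℓ)` and the class law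
(crux `StarGO2Sigma`, stmt-BirchSwinnertonDyer-27046; planner bsd-rank2-p2 GEN 38, split for the 400-line rule by the lead)

Second half of p2 GEN 38 PART 10b (`KEtaHondaPoint.lean`): with `U = Z_c²(x_W(Z_c) − x₀) ∈ ℤ⟦q⟧`,
**`U² − U(q²)·(1 + 2c·G) ∈ 4ℤ⟦q⟧`**, `G = Σ_{v₂(n) even} a_{n′}(W) qⁿ`, for every `W/ℚ` globally minimal and ordinary at `2`
with an étale rational `2`-torsion abscissa and every multiplier `c ∈ ℤ` (`kummerClassLaw_hondaPoint_of_rationalTwoTorsion`);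
interface lemmas `param`, `classPattern`, `exists_int_hondaU`, `constantCoeff_hondaU` for the kummer v7 glue.  §A–§C are part 10b-A.
Nothing here reads `r_an`; `StarGO2Sigma` / E1M / BSD are NOT proved by this file.
-/

set_option linter.dupNamespace false
set_option linter.unusedSectionVars false
set_option autoImplicit false

noncomputable section

namespace Summit.BirchSwinnertonDyer.BirchSwinnertonDyer.Theorems.DepletionAtTwo.KEta.HondaPoint

open PowerSeries Literature.RingTheory.FormalGroups Literature.NumberTheory.EllipticCurves

/-! ## §D The Honda point `Z_c = exp_W(c·ℓ)` and the class law `U² − U(q²)(1 + 2cG) ∈ 4ℤ⟦q⟧` -/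

/-- `(X²(x − x₀)) ∘ T = (X²x) ∘ T − x₀ T²`. -/
theorem subst_formalXMulSq_sub {R : Type*} [CommRing R] (V : WeierstrassCurve R) (x₀ : R) {T : PowerSeries R}
    (hT : HasSubst T) :
    (V.formalXMulSq - C x₀ * X ^ 2).subst T = V.formalXMulSq.subst T - C x₀ * T ^ 2 := by
  rw [subst_sub hT, ← smul_eq_C_mul, subst_smul hT, subst_pow hT, subst_X hT, smul_eq_C_mul]

/-- `4r ∈ ℤ₂` comes from `4ℤ`. -/
theorem int_four_dvd_of_padicInt {e : ℤ} {r : ℤ_[2]} (h : (e : ℤ_[2]) = 4 * r) : (4 : ℤ) ∣ e := by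
  have h' := congrArg (PadicInt.toZModPow (p := 2) 2) h
  rw [map_intCast, map_mul, map_ofNat] at h'
  change ((e : ℤ) : ZMod 4) = (4 : ZMod 4) * PadicInt.toZModPow (p := 2) 2 r at h'
  rw [show (4 : ZMod 4) = 0 from rfl, zero_mul] at h'
  exact_mod_cast (ZMod.intCast_zmod_eq_zero_iff_dvd e 4).mp h'

/-- A rational `2`-torsion abscissa with `v₂(x₀) ≥ 0` of an integral Weierstrass equation is an INTEGER
(its denominator divides `4` by the `2`-division cubic `4x³ + b₂x² + 2b₄x + b₆`, and is odd). -/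
theorem exists_int_eq_of_twoTorsionX (W : WeierstrassCurve ℤ) {x₀ : ℚ}
    (hx : Greenberg1999.HasRationalTwoTorsionX (W.map (Int.castRingHom ℚ)) x₀)
    (hv : ¬ Greenberg1999.TwoTorsionRamifiedAtTwo x₀) : ∃ m : ℤ, (m : ℚ) = x₀ := by
  obtain ⟨ξ, hξ, -⟩ := TheoremKPadic.exists_padicInt_twoTorsionX W hx hv
  obtain ⟨y, heq, h2⟩ := hx
  rw [WeierstrassCurve.Affine.equation_iff] at heq
  simp only [WeierstrassCurve.toAffine, WeierstrassCurve.map_a₁, WeierstrassCurve.map_a₂,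
    WeierstrassCurve.map_a₃, WeierstrassCurve.map_a₄, WeierstrassCurve.map_a₆, eq_intCast] at heq h2
  have hcubic : 4 * x₀ ^ 3 + (W.b₂ : ℚ) * x₀ ^ 2 + 2 * (W.b₄ : ℚ) * x₀ + (W.b₆ : ℚ) = 0 := by
    simp only [WeierstrassCurve.b₂, WeierstrassCurve.b₄, WeierstrassCurve.b₆]; push_cast
    linear_combination (2 * y + (W.a₁ : ℚ) * x₀ + W.a₃) * h2 - 4 * heq
  set u : ℤ := x₀.num with hu
  set v : ℕ := x₀.den with hvd
  have hxv : x₀ * v = u := Rat.mul_den_eq_num x₀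
  have hZ : (4 * (u : ℚ) ^ 3 + W.b₂ * (u : ℚ) ^ 2 * v + 2 * W.b₄ * u * (v : ℚ) ^ 2 + W.b₆ * (v : ℚ) ^ 3 : ℚ) = 0 := by
    linear_combination (v : ℚ) ^ 3 * hcubic -
      (4 * ((u : ℚ) ^ 2 + u * (x₀ * v) + (x₀ * v) ^ 2) + W.b₂ * v * (u + x₀ * v) + 2 * W.b₄ * (v : ℚ) ^ 2) * hxv
  have hZ' : 4 * u ^ 3 + W.b₂ * u ^ 2 * v + 2 * W.b₄ * u * (v : ℤ) ^ 2 + W.b₆ * (v : ℤ) ^ 3 = 0 := by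
    exact_mod_cast hZ
  -- `v ∣ 4`
  have hcop : IsCoprime (v : ℤ) (u ^ 3) := by
    refine IsCoprime.pow_right (Int.isCoprime_iff_gcd_eq_one.mpr ?_)
    rw [Int.gcd_comm]
    show u.natAbs.gcd (v : ℤ).natAbs = 1
    rw [Int.natAbs_natCast]
    exact x₀.reduced
  have hvdvd : (v : ℤ) ∣ 4 := by
    have h4 : (v : ℤ) ∣ 4 * u ^ 3 :=
      ⟨-(W.b₂ * u ^ 2 + 2 * W.b₄ * u * v + W.b₆ * (v : ℤ) ^ 2), by linear_combination hZ'⟩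
    exact hcop.dvd_of_dvd_mul_right h4
  -- `2 ∤ v` (from `‖x₀‖₂ ≤ 1`)
  have hv2 : ¬ 2 ∣ v := fun h2v => by
    have h1 : ξ * ((v : ℕ) : ℤ_[2]) = (u : ℤ_[2]) := by
      apply Subtype.ext
      push_cast
      rw [hξ]
      exact_mod_cast congrArg (fun r : ℚ => (r : ℚ_[2])) hxv
    have hlt : ‖(u : ℤ_[2])‖ < 1 := by
      rw [← h1, norm_mul]
      calc ‖ξ‖ * ‖((v : ℕ) : ℤ_[2])‖ ≤ 1 * ‖((v : ℕ) : ℤ_[2])‖ :=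
            mul_le_mul_of_nonneg_right (PadicInt.norm_le_one ξ) (norm_nonneg _)
        _ < 1 := by rw [one_mul]; exact PadicInt.norm_natCast_lt_one_iff.mpr h2v
    have h2u : (2 : ℤ) ∣ u := by exact_mod_cast (PadicInt.norm_intCast_lt_one_iff.mp hlt)
    have hg : 2 ∣ Nat.gcd u.natAbs v := Nat.dvd_gcd (Int.natAbs_dvd_natAbs.mpr h2u) h2v
    rw [Nat.Coprime.gcd_eq_one x₀.reduced] at hg
    exact absurd (Nat.le_of_dvd one_pos hg) (by norm_num)
  -- hence `v = 1`
  have hv1 : v = 1 := by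
    have hv4 : v ∣ 2 ^ 2 := by exact_mod_cast hvdvd
    have hcop2 : Nat.Coprime v (2 ^ 2) :=
      (((Nat.Prime.coprime_iff_not_dvd Nat.prime_two).mpr hv2).symm).pow_right 2
    exact Nat.Coprime.eq_one_of_dvd hcop2 hv4
  refine ⟨u, ?_⟩
  rw [← hxv, hv1, Nat.cast_one, mul_one]

section HondaPoint

open WeierstrassCurve

variable (W : WeierstrassCurve ℚ) [W.IsElliptic] [W.IsGloballyMinimal]

/-- **The Honda point** `Z_c = exp_W(c·ℓ) ∈ ℚ⟦q⟧`, `ℓ = Σ aₙ(W) qⁿ/n` — the modular parametrisation composed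
with the formal-group parameter, for an arbitrary multiplier `c ∈ ℤ`. -/
def param (c : ℤ) : ℚ⟦X⟧ := W.formalExp.subst ((c : ℚ) • ell W)

/-- **The class pattern** `G = Σ_{n ≥ 1, v₂(n) even} a_{n′}(W) qⁿ ∈ ℤ⟦q⟧`, `n′ = n/2^{v₂(n)}`. -/
def classPattern : ℤ⟦X⟧ := patSeries fun n => (W.LFunction n : ℤ)

/-- Auxiliary (constantCoeff smul ell): bookkeeping lemma of p2 GEN 38 PART 10 (THEOREM K at the Honda point). [folklore] -/
theorem constantCoeff_smul_ell (c : ℤ) : constantCoeff ((c : ℚ) • ell W) = 0 := by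
  rw [smul_eq_C_mul, map_mul, constantCoeff_ell, mul_zero]

/-- Auxiliary (hasSubst smul ell): bookkeeping lemma of p2 GEN 38 PART 10 (THEOREM K at the Honda point). [folklore] -/
theorem hasSubst_smul_ell (c : ℤ) : HasSubst ((c : ℚ) • ell W) :=
  HasSubst.of_constantCoeff_zero' (constantCoeff_smul_ell W c)

/-- `log_W(Z_c) = c·ℓ`. -/
theorem formalLog_subst_param (c : ℤ) : W.formalLog.subst (param W c) = (c : ℚ) • ell W := by
  rw [param, ← subst_comp_subst_apply (hasSubst_formalExp W) (hasSubst_smul_ell W c),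
    W.formalLog_subst_formalExp, subst_X (hasSubst_smul_ell W c)]

/-- Auxiliary (constantCoeff param): bookkeeping lemma of p2 GEN 38 PART 10 (THEOREM K at the Honda point). [folklore] -/
theorem constantCoeff_param (c : ℤ) : constantCoeff (param W c) = 0 := by
  rw [param, Kernel.constantCoeff_subst_of_constantCoeff_eq_zero (constantCoeff_smul_ell W c) W.formalExp,
    WeierstrassCurve.constantCoeff_formalExp]

/-- Auxiliary (hasSubst param): bookkeeping lemma of p2 GEN 38 PART 10 (THEOREM K at the Honda point). [folklore] -/
theorem hasSubst_param (c : ℤ) : HasSubst (param W c) :=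
  HasSubst.of_constantCoeff_zero' (constantCoeff_param W c)

/-- `Z_c ∈ ℤ⟦q⟧` (tree `ParamIntegral.exists_int_coeff_formalExp_subst_lSeriesLog`). -/
theorem exists_paramInt (c : ℤ) : ∃ Z : ℤ⟦X⟧, Z.map (Int.castRingHom ℚ) = param W c := by
  choose zc hzc using fun n => ParamIntegral.exists_int_coeff_formalExp_subst_lSeriesLog W c n
  refine ⟨PowerSeries.mk zc, ?_⟩
  ext n
  rw [coeff_map, coeff_mk, eq_intCast, ← hzc n]
  rfl

/-- `U = Z_c²·(x_W(Z_c) − x₀)` has INTEGER coefficients (Honda: `Z_c ∈ ℤ⟦q⟧`; `x_W(T)·T² ∈ ℤ[a_i]⟦T⟧` on the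
integral model).  Interface lemma for the kummer v7 glue (the square criterion wants an integral series). -/
theorem exists_int_hondaU (x₀ : ℤ) (c : ℤ) : ∃ Uℤ : ℤ⟦X⟧,
    Uℤ.map (Int.castRingHom ℚ) = W.formalXMulSq.subst (param W c) - C (x₀ : ℚ) * param W c ^ 2 := by
  obtain ⟨Zℤ, hZℚ⟩ := exists_paramInt W c
  have hZℤ0 : constantCoeff Zℤ = 0 := by
    have h := congrArg constantCoeff hZℚ
    rw [KummerAlg.constantCoeff_map', constantCoeff_param, eq_intCast, Int.cast_eq_zero] at h
    exact h
  have hZℤs : HasSubst Zℤ := HasSubst.of_constantCoeff_zero' hZℤ0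
  refine ⟨(integralModelInt W).formalXMulSq.subst Zℤ - C x₀ * Zℤ ^ 2, ?_⟩
  rw [map_sub, Kernel.map_subst_apply' hZℤs, WeierstrassCurve.map_formalXMulSq, map_integralModelInt, hZℚ,
    map_mul, map_C, map_pow, hZℚ, eq_intCast]

/-- `U(0) = 1` (`Z_c(0) = 0`, `x_W(T)·T² = 1 − a₁T − …`). Interface lemma for the kummer v7 glue. -/
theorem constantCoeff_hondaU (x₀ : ℚ) (c : ℤ) :
    constantCoeff (W.formalXMulSq.subst (param W c) - C x₀ * param W c ^ 2) = 1 := by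
  rw [map_sub, Kernel.constantCoeff_subst_of_constantCoeff_eq_zero (constantCoeff_param W c),
    WeierstrassCurve.constantCoeff_formalXMulSq, map_mul, map_pow, constantCoeff_param, constantCoeff_C]
  ring

/-- **THEOREM K AT THE HONDA POINT = the `2`-adic Kummer class law `KummerClassLawAtTwo` (K-ETA.md (★η)),
for every multiplier `c ∈ ℤ`.**  Let `W/ℚ` be globally minimal and ORDINARY at `2` (good reduction, `2 ∤ a₂`),
`x₀ ∈ ℤ` the abscissa of a rational point of order `2`, `c ∈ ℤ`, `Z_c = exp_W(c·Σ aₙqⁿ/n) ∈ ℤ⟦q⟧` the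
Honda point, `U = Z_c²·(x_W(Z_c) − x₀) ∈ ℤ⟦q⟧` and `G = Σ_{v₂(n) even} a_{n′} qⁿ`.  Then
`U² − U(q²)·(1 + 2c·G) ∈ 4ℤ⟦q⟧`:
the Kummer class of `U` in `(1 + 2qℤ₂⟦q⟧)/squares ≅ 𝔽₂⟦q⟧/℘` is the `L`-series pattern `c̄·Ḡ`. -/
theorem kummerClassLaw_hondaPoint (hord : IsOrdinaryAt W 2) (x₀ : ℤ)
    (hx : Greenberg1999.HasRationalTwoTorsionX W (x₀ : ℚ)) (c : ℤ) (n : ℕ) :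
    ∃ kk : ℤ, coeff n
      ((W.formalXMulSq.subst (param W c) - C (x₀ : ℚ) * param W c ^ 2) ^ 2 -
        expand 2 two_ne_zero (W.formalXMulSq.subst (param W c) - C (x₀ : ℚ) * param W c ^ 2) *
          (1 + 2 * C (c : ℚ) * (classPattern W).map (Int.castRingHom ℚ))) = 4 * (kk : ℚ) := by
  -- the integral model and its reductions
  set Wℤ := integralModelInt W with hWℤ
  have hWℚ : Wℤ.map (Int.castRingHom ℚ) = W := map_integralModelInt W
  haveI hell : ((Wℤ.map (Int.castRingHom ℤ_[2])).map (PadicInt.toZMod (p := 2))).IsElliptic :=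
    LineAdapter.isElliptic_specialFibre_two W hord.1
  have ha1 : Odd Wℤ.a₁ := LineAdapter.odd_a₁_integralModelInt_of_isOrdinaryAt W hord
  have hgood : ¬ (2 : ℤ) ∣ minimalDiscriminantInt W := by
    exact_mod_cast not_dvd_minimalDiscriminantInt_of_hasGoodReductionAtPrime (W := W) 2 hord.1
  obtain ⟨α, hαn, hroot⟩ := TheoremKPadic.exists_unitRoot_tr Wℤ ha1
  have hH := TheoremKPadic.hondaType_of_goodReduction Wℤ
  have htr : (HasseManin.tr ((Wℤ.map (Int.castRingHom ℤ_[2])).map (PadicInt.toZMod (p := 2))) : ℤ) =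
      W.LFunction 2 := by
    rw [hWℤ, ← LineAdapter.frobeniusTrace_two_eq_tr', LFunction_apply_prime_eq_frobeniusTrace W 2 hord.1]
  have hrootL : (α : ℚ_[2]) ^ 2 - ((W.LFunction 2 : ℤ) : ℚ_[2]) * α + 2 = 0 := by rw [← htr]; exact hroot
  have hrootL' : (α : ℚ_[2]) ^ 2 - ((W.LFunction 2 : ℤ) : ℚ_[2]) * α + (2 : ℕ) = 0 := by
    exact_mod_cast hrootL
  -- the `2`-torsion abscissa in `ℤ₂`
  have hv : ¬ Greenberg1999.TwoTorsionRamifiedAtTwo (x₀ : ℚ) := by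
    rw [Greenberg1999.twoTorsionRamifiedAtTwo_iff, not_lt, padicValRat.of_int]
    exact_mod_cast Nat.zero_le _
  have hxℤ : Greenberg1999.HasRationalTwoTorsionX (Wℤ.map (Int.castRingHom ℚ)) (x₀ : ℚ) := by
    rw [hWℚ]; exact hx
  obtain ⟨ξ, hξ, hxξ⟩ := TheoremKPadic.exists_padicInt_twoTorsionX Wℤ hxℤ hv
  have hξx : ξ = (x₀ : ℤ_[2]) := by
    apply Subtype.ext
    rw [hξ, Rat.cast_intCast]
    rfl
  rw [hξx] at hxξ
  -- the Honda point over `ℤ` and `ℤ₂`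
  obtain ⟨Zℤ, hZℚ⟩ := exists_paramInt W c
  have hZℤ0 : constantCoeff Zℤ = 0 := by
    have h := congrArg constantCoeff hZℚ
    rw [KummerAlg.constantCoeff_map', constantCoeff_param, eq_intCast, Int.cast_eq_zero] at h
    exact h
  have hZℤs : HasSubst Zℤ := HasSubst.of_constantCoeff_zero' hZℤ0
  set Z₂ : PowerSeries ℤ_[2] := Zℤ.map (Int.castRingHom ℤ_[2]) with hZ₂
  have hZ₂0 : constantCoeff Z₂ = 0 := by rw [hZ₂, KummerAlg.constantCoeff_map', hZℤ0, map_zero]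
  have hZ₂s : HasSubst Z₂ := HasSubst.of_constantCoeff_zero' hZ₂0
  -- `log_W(Z_c) = c·ℓ` read in `ℚ₂⟦q⟧`
  have hWℚ₂ : Wℤ.map (Int.castRingHom ℚ_[2]) = W.map (algebraMap ℚ ℚ_[2]) := by
    conv_rhs => rw [← hWℚ, WeierstrassCurve.map_map]
    congr 1
  have hZ₂ℚ : Z₂.map (PadicInt.Coe.ringHom (p := 2)) = (param W c).map (algebraMap ℚ ℚ_[2]) := by
    rw [hZ₂, Kernel.map_map_apply', ← hZℚ, Kernel.map_map_apply']
    congr 1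
  have hLZ : ((Wℤ.map (Int.castRingHom ℚ_[2])).formalLog).subst (Z₂.map (PadicInt.Coe.ringHom (p := 2))) =
      C ((c : ℚ_[2])) * ellTwo W := by
    rw [hZ₂ℚ, hWℚ₂, ← WeierstrassCurve.map_formalLog,
      ← Kernel.map_subst_apply' (hasSubst_param W c) (algebraMap ℚ ℚ_[2]) W.formalLog,
      formalLog_subst_param, smul_eq_C_mul, map_mul, map_C, ell_map, map_intCast]
  -- the integral `λ`-series of `ℓ` and `M = c·Λ`
  obtain ⟨Λ, hΛ⟩ := HondaLambda.exists_frobLambda_eq_map hαn hrootL' (constantCoeff_ellTwo W)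
    (hondaType_ellTwo W hgood)
  set M : PowerSeries ℤ_[2] := C (c : ℤ_[2]) * Λ with hMdef
  have hM : M.map (PadicInt.Coe.ringHom (p := 2)) = HondaLambda.frobLambda (α : ℚ_[2])
      (((Wℤ.map (Int.castRingHom ℚ_[2])).formalLog).subst (Z₂.map (PadicInt.Coe.ringHom (p := 2)))) := by
    rw [hLZ, frobLambda_C_mul, hMdef, map_mul, map_C, map_intCast, hΛ]
  -- the Dwork witness of `U₂ = g ∘ Z₂` and THEOREM K along `Z₂`
  set g₂ : PowerSeries ℤ_[2] := (Wℤ.map (Int.castRingHom ℤ_[2])).formalXMulSq - C (x₀ : ℤ_[2]) * X ^ 2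
    with hg₂
  obtain ⟨δ, hδ⟩ := TheoremKPadic.exists_delta_padicInt (g₂.subst Z₂)
  have KEY := classLaw_padicInt_subst Wℤ _ hαn hroot hH hxξ ha1 hZ₂0 hM hδ
  -- the pattern: `asRoot(M̄) = c̄·Ḡ`
  set ρ : ℤ_[2] →+* ZMod 2 := PadicInt.toZMod (p := 2) with hρ
  set G₂ : PowerSeries ℤ_[2] := (classPattern W).map (Int.castRingHom ℤ_[2]) with hG₂
  have hΛρ : Λ.map ρ = lamSeries (fun m => ((W.LFunction m : ℤ) : ZMod 2)) :=
    map_toZMod_eq_lamSeries W hgood hαn hrootL hΛ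
  have hMρ : M.map ρ = C (ρ c) * lamSeries (fun m => ((W.LFunction m : ℤ) : ZMod 2)) := by
    rw [hMdef, map_mul, map_C, hΛρ]
  have hGρ : (C (c : ℤ_[2]) * G₂).map ρ = C (ρ c) * patSeries (fun m => ((W.LFunction m : ℤ) : ZMod 2)) := by
    rw [map_mul, map_C, hG₂, Kernel.map_map_apply', classPattern, patSeries_map]
    congr 2
    funext m
    rw [RingHom.comp_apply, eq_intCast, map_intCast]
  have hMρ0 : constantCoeff (M.map ρ) = 0 := by rw [hMρ, map_mul, constantCoeff_lamSeries, mul_zero]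
  have hT : ArtinSchreier.asRoot (M.map ρ) = (C (c : ℤ_[2]) * G₂).map ρ := by
    refine ArtinSchreier.as_unique (ArtinSchreier.asRoot_spec hMρ0) ?_
      (ArtinSchreier.constantCoeff_asRoot hMρ0) ?_
    · rw [hGρ, hMρ, C_mul_patSeries_sub_sq]
    · rw [hGρ, map_mul, constantCoeff_patSeries, mul_zero]
  rw [hT] at KEY
  -- `δ + c·G₂·U₂²` vanishes modulo `2`
  have hsym : ∀ A B : PowerSeries (ZMod 2), A * B + B * A = 0 := fun A B => by
    rw [mul_comm B A, ← two_mul, ArtinSchreier.two_eq_zero_powerSeries, zero_mul]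
  have hvan : (δ + C (c : ℤ_[2]) * G₂ * (g₂.subst Z₂) ^ 2).map ρ = 0 := by
    rw [map_add, KEY]
    simp only [map_mul, map_pow]
    exact hsym _ _
  obtain ⟨R, hR⟩ := Kernel.exists_eq_two_mul_of_map_eq_zero Kernel.frobeniusLift_padicInt_two.2.1 hvan
  -- `E₂ = 4·(−R − c·G₂·δ)`
  have hexp : expand 2 two_ne_zero (g₂.subst Z₂) = (g₂.subst Z₂) ^ 2 + 2 * δ := by
    rw [← hδ, Kernel.phi_def, PowerSeries.map_id]
    rfl
  have hE₂ : (g₂.subst Z₂) ^ 2 - expand 2 two_ne_zero (g₂.subst Z₂) * (1 + 2 * C (c : ℤ_[2]) * G₂) =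
      4 * (-R - C (c : ℤ_[2]) * G₂ * δ) := by
    rw [hexp]
    linear_combination (-2 : PowerSeries ℤ_[2]) * hR
  -- back to `ℤ` and `ℚ`
  set Uℤ : PowerSeries ℤ := Wℤ.formalXMulSq.subst Zℤ - C x₀ * Zℤ ^ 2 with hUℤ
  set Eℤ : PowerSeries ℤ := Uℤ ^ 2 - expand 2 two_ne_zero Uℤ * (1 + 2 * C c * classPattern W) with hEℤ
  have hUℚ : Uℤ.map (Int.castRingHom ℚ) = W.formalXMulSq.subst (param W c) - C (x₀ : ℚ) * param W c ^ 2 := by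
    rw [hUℤ, map_sub, Kernel.map_subst_apply' hZℤs, WeierstrassCurve.map_formalXMulSq, hWℚ, hZℚ, map_mul, map_C,
      map_pow, hZℚ, eq_intCast]
  have hEℚ : Eℤ.map (Int.castRingHom ℚ) =
      (W.formalXMulSq.subst (param W c) - C (x₀ : ℚ) * param W c ^ 2) ^ 2 -
        expand 2 two_ne_zero (W.formalXMulSq.subst (param W c) - C (x₀ : ℚ) * param W c ^ 2) *
          (1 + 2 * C (c : ℚ) * (classPattern W).map (Int.castRingHom ℚ)) := by
    rw [hEℤ, map_sub, map_pow, map_mul, map_expand, hUℚ, map_add, map_one, map_mul, map_mul, map_ofNat, map_C,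
      eq_intCast]
  have hU₂ : Uℤ.map (Int.castRingHom ℤ_[2]) = g₂.subst Z₂ := by
    rw [hUℤ, hg₂, subst_formalXMulSq_sub _ _ hZ₂s, map_sub, Kernel.map_subst_apply' hZℤs,
      WeierstrassCurve.map_formalXMulSq, ← hZ₂, map_mul, map_C, map_pow, ← hZ₂, eq_intCast]
  have hE₂' : Eℤ.map (Int.castRingHom ℤ_[2]) = 4 * (-R - C (c : ℤ_[2]) * G₂ * δ) := by
    rw [← hE₂, hEℤ, map_sub, map_pow, map_mul, map_expand, hU₂, map_add, map_one, map_mul, map_mul, map_ofNat,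
      map_C, eq_intCast, ← hG₂]
  have hdiv : (4 : ℤ) ∣ coeff n Eℤ := by
    have h := congrArg (coeff n) hE₂'
    rw [coeff_map, eq_intCast, show (4 : PowerSeries ℤ_[2]) = C (4 : ℤ_[2]) from (map_ofNat C 4).symm,
      coeff_C_mul] at h
    exact int_four_dvd_of_padicInt h
  obtain ⟨kk, hkk⟩ := hdiv
  refine ⟨kk, ?_⟩
  rw [← hEℚ, coeff_map, hkk, eq_intCast]
  push_cast
  ring

/-- **THEOREM K AT THE HONDA POINT on the kummer line's binders** (`x₀ ∈ ℚ` with `v₂(x₀) ≥ 0` — then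
`x₀ ∈ ℤ` automatically, `exists_int_eq_of_twoTorsionX`). -/
theorem kummerClassLaw_hondaPoint_of_rationalTwoTorsion (hord : IsOrdinaryAt W 2) {x₀ : ℚ}
    (hx : Greenberg1999.HasRationalTwoTorsionX W x₀) (hv : ¬ Greenberg1999.TwoTorsionRamifiedAtTwo x₀)
    (c : ℤ) (n : ℕ) :
    ∃ kk : ℤ, coeff n
      ((W.formalXMulSq.subst (param W c) - C x₀ * param W c ^ 2) ^ 2 -
        expand 2 two_ne_zero (W.formalXMulSq.subst (param W c) - C x₀ * param W c ^ 2) *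
          (1 + 2 * C (c : ℚ) * (classPattern W).map (Int.castRingHom ℚ))) = 4 * (kk : ℚ) := by
  obtain ⟨m, rfl⟩ := exists_int_eq_of_twoTorsionX (integralModelInt W) (by rwa [map_integralModelInt]) hv
  exact kummerClassLaw_hondaPoint W hord m hx c n

end HondaPoint

end Summit.BirchSwinnertonDyer.BirchSwinnertonDyer.Theorems.DepletionAtTwo.KEta.HondaPoint

end
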